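import Summits.BirchSwinnertonDyer.Rank1Residual.Additive.KatoDescentStrictSelmerLevel
import Summits.BirchSwinnertonDyer.Rank1Residual.Additive.KatoDescentKummerUnramifiedCompactSide
import Summits.BirchSwinnertonDyer.BirchSwinnertonDyer.Theorems.KatoDescentPotSupersingularKatoFiniteLevelStrictFinite
import Summits.BirchSwinnertonDyer.BirchSwinnertonDyer.Theorems.KatoDescentPotSupersingularKatoSelmerPTLocal
import Summits.BirchSwinnertonDyer.BirchSwinnertonDyer.Theorems.CongruentShaFreeCutKatoKummerLogTorsion
import Literature.NumberTheory.EllipticCurves.NeronOggShafarevichLocal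
import HarnessLib

set_option autoImplicit false

/-!
# THE STRICT SELMER COUNT ON THE RANK-ONE ROWS: `v_p #Sel_str + v_p #W(ℚ_p)[p^∞] + a = v_p #Ш[p^∞] + v_p Tam(W) + v(log_ω P)`
# (seat `bsd-cm-prr-ty1` g12, cell `bsd-cm`; theorems only: no definition, no named fact, no instance, no `sorry`)

Part 31b of the seat's kernel cut of stub 3 `stub_rankOneCountReadingKato` of the Kato–Perrin-Riou skeletons v4 (cruxes
stmt-BirchSwinnertonDyer-19945 / -19223; = cell bsd-potss's held input 27322); plan (α)-I of planner D512 (3) / D514 (2) /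
D519.  `Kato2004.KatoH2CountAt W p n` reads «`n · #W(ℚ)[p^∞] = #Sel_str · #W(ℚ_p)[p^∞]`», `Sel_str =
Kato2004.katoStrictSelmer W p {v_p}` (classes of `H¹(ℚ, W[p^∞])` unramified off `p`, locally trivial at `p`; (14.14.2) +
(14.9.3) give it for `n = #(𝐇²_Γ)_Γ`); COUNT-FINEᵃ (Part 20) reads «`v_p #desc(I) + v_p #(X₀)_Γ − v_p #X₀^Γ + a =
v_p #Ш[p^∞] + v_p Tam + v(log_ω P)`».  (R1-d) (Part 30) supplies `[S_Σ : Sel_{p^∞}] · p^a = ∏_{ℓ∈Σ} p^{v_p c_ℓ}`; Part 31a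
supplies `#(S ⊓ Sel_str@E) = p^ñ · [S : Sel_{p^∞}] · #Ш[p^∞]`, `ñ = v(log_ω P) − e`, `e = t − v_p(c_p)`.  THIS FILE:
* §1 **`katoStrictSelmer_eq_inf_strict`**: for the subgroup `S_Σ` of Part 30 (Selmer off `Σ`, unramified at `Σ ⊇ bad ≠ p`,
  characterised by membership), `katoStrictSelmer W p {v_p} = S_Σ ⊓ Sel_str@ℚ_{v_p}` (potss `StrictSelmerBridge`,
  `KatoFiniteLevelCount.mem_selmerLocalKerPrimary_*`; X11b `unramifiedSubgroup_primary_eq_bot` at the good places).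
* §2 `eq_of_integralH1_eq_span_pow_smul` (the lattice exponent `a` is well defined), `tamagawaProduct_eq_prod_mul_padic`
  (`Tam = (∏_{ℓ∈Σ} c_ℓ) · c_p`), and **`finite_katoStrictSelmer_and_padicValNat_card_eq`** — ON THE ROWS (`W/ℚ` globally
  minimal of rank one generated by `P` modulo torsion, `Ш[p^∞]` finite, `p ∤ #W(ℚ)_tors`, `p` odd, `Addv W p`, `Σ` = additive
  places `≠ p` containing every bad `ℓ ≠ p`, `x = κ_∞(P)`, `H¹(ℤ[1/p],T_pW) = ℤ_p ∙ p^a x`; `W(ℚ_p)[p] ≠ 0` ALLOWED):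
  `Sel_str` is FINITE and **`v_p #Sel_str + v_p #W(ℚ_p)[p^∞] + a = v_p #Ш[p^∞] + v_p Tam(W) + v(log_ω P)`**.
HONEST LABEL: theorems only; no stub or item is closed; nothing is registered; nothing is asserted on 19945 / 19223;
Kato's Main Conjecture and Perrin-Riou's conjecture are not touched; BSD is not proved for any curve.
References: [Kato2004Asterisque] §14.1 (p. 235), (14.9.3) (p. 240), (14.14.2) (p. 243), Prop. 14.16, 14.18 (p. 244);
[GreenbergLNM1716] §2–§3; [KuriharaPollack2007] §1.5 (p. 361); [Kim2022StructureSelmer] §3.2.3, Lemma 3.10;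
[SilvermanAEC2009] VII.§2, Cor. VII.6.2; [BlochKato1990] Ex. 3.11.
-/

noncomputable section

open scoped Classical NumberField ContRepresentation

open WeierstrassCurve Field IsDedekindDomain NumberField CategoryTheory Literature.NumberTheory.EllipticCurves
  Literature.NumberTheory.EllipticCurves.Kato2004 Literature.NumberTheory.GaloisRepresentations
  Literature.NumberTheory.GaloisRepresentations.DiscreteGaloisModule
  Literature.NumberTheory.EllipticCurves.Kato2004.EulerSystemValues
open WeierstrassCurve (geomPoints geomTorsion geomPrimaryTorsion galH1Primary kummerMapTorsion)
open Summit.BirchSwinnertonDyer.Rank1Residual.Additive.StrictSha Summit.BirchSwinnertonDyer.Rank1Residual.X12.O11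
open Summit.BirchSwinnertonDyer.Rank1Residual.X11b.LocBridge Literature.NumberTheory.EllipticCurves.Rank1Residual

namespace Summit.BirchSwinnertonDyer.Rank1Residual.Additive.StrictCount

/-! ## §1 `Sel_str = S_Σ ⊓ Sel_str@v_p` -/

section Strict

/-- **Kato's strict Selmer group is `S_Σ ⊓ Sel_str@v_p`.** Over `ℚ`, `p` odd, `Σ` (`= Q`) a finite set of places `≠ v_p`
containing every bad `ℓ ≠ p`, `S_Σ ≤ H¹(ℚ, W[p^∞])` THE subgroup «`p^∞`-Selmer local kernel off `Σ`, unramified at `Σ`»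
(Part 30, characterised by membership): `katoStrictSelmer W p {v_p}` (unramified off `p`, locally trivial at `p`)
`= S_Σ ⊓ selmerLocalKerPrimaryTorsion W ℚ_{v_p} p`: at `v ∈ Σ` both sides ask "unramified" (potss `StrictSelmerBridge`); at
the GOOD `v ∉ Σ ∪ {v_p}`, `H¹_ur(ℚ_v, W[p^∞]) = 0` (X11b `unramifiedSubgroup_primary_eq_bot`) and the Selmer kernel is
«`loc_v = 0`» (potss `KatoFiniteLevelCount`); at `∞` every class is Selmer (`p` odd); at `v_p` «`loc = 0`» is the strict
condition (Part 31a §3). [cite: Kato2004Asterisque, §14.1 (p. 235) and (14.9.3) (p. 240)] [cite: GreenbergLNM1716, §2–§3] -/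
theorem katoStrictSelmer_eq_inf_strict (W : WeierstrassCurve ℚ) [W.IsElliptic] (p : ℕ) [Fact p.Prime] (hodd : p ≠ 2)
    (Q : Finset (HeightOneSpectrum (𝓞 ℚ)))
    (hQp : ∀ v ∈ Q, ((Rat.HeightOneSpectrum.primesEquiv v : Nat.Primes) : ℕ) ≠ p)
    (hQbad : ∀ v : HeightOneSpectrum (𝓞 ℚ), v ∈ W.badPlaces (𝓞 ℚ) →
      ((Rat.HeightOneSpectrum.primesEquiv v : Nat.Primes) : ℕ) ≠ p → v ∈ Q)
    (S : AddSubgroup (W.galH1Primary p))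
    (hS : ∀ y, y ∈ S ↔
      (∀ v : HeightOneSpectrum (𝓞 ℚ), v ∉ Q → y ∈ selmerLocalKerPrimary W (v.adicCompletion ℚ) p) ∧
      (∀ w : InfinitePlace ℚ, y ∈ selmerLocalKerPrimary W w.Completion p) ∧
      (∀ v ∈ Q, galoisCohomology.localization (primaryGaloisModule W p) (Sum.inr v) 1 y ∈
        unramifiedSubgroup (GaloisRep.toLocal v (primaryGaloisModule W p)) 1)) :
    katoStrictSelmer W p {primePlace p} =
      S ⊓ selmerLocalKerPrimaryTorsion W ((primePlace p).adicCompletion ℚ) p := by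
  have hp : p.Prime := Fact.out
  have hvpQ : primePlace p ∉ Q := fun h => hQp _ h (coe_primesEquiv_primePlace p)
  -- at a good place `v ∉ Q ∪ {v_p}`: `H¹_ur(ℚ_v, W[p^∞]) = 0`
  have hgood : ∀ v : HeightOneSpectrum (𝓞 ℚ), v ∉ Q → v ≠ primePlace p →
      unramifiedSubgroup (GaloisRep.restrictField (v.adicCompletion ℚ) (primaryGaloisModule W p)) 1 = ⊥ := by
    intro v hvQ hvp
    have hne : ((Rat.HeightOneSpectrum.primesEquiv v : Nat.Primes) : ℕ) ≠ p := by
      intro h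
      apply hvp
      apply (Rat.HeightOneSpectrum.primesEquiv (R := 𝓞 ℚ)).injective
      rw [primesEquiv_primePlace]
      exact Subtype.ext h
    have hgoodv : W.HasGoodReductionAt v := by
      by_contra hbad
      exact hvQ (hQbad v ((W.mem_badPlaces_iff v).mpr hbad) hne)
    exact unramifiedSubgroup_primary_eq_bot W p (WeierstrassCurve.natCast_not_mem_asIdeal_of_primesEquiv_ne hp hne) hgoodv
  ext c
  rw [BirchSwinnertonDyer.Theorems.StrictSelmerBridge.mem_katoStrictSelmer_iff, AddSubgroup.mem_inf, hS,
    mem_selmerLocalKerPrimaryTorsion_adicCompletion_iff_localization_eq_zero]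
  constructor
  · rintro ⟨hP, hur⟩
    have h0 : galoisCohomology.localization (primaryGaloisModule W p) (Sum.inr (primePlace p)) 1 c = 0 :=
      (BirchSwinnertonDyer.Theorems.StrictSelmerBridge.localization_primary_eq_zero_iff_mem_subgroupResKer W p _ c).mpr
        (hP _ (Set.mem_singleton _))
    have hur' : ∀ v : HeightOneSpectrum (𝓞 ℚ), v ≠ primePlace p →
        galoisCohomology.localization (primaryGaloisModule W p) (Sum.inr v) 1 c ∈
          unramifiedSubgroup (GaloisRep.toLocal v (primaryGaloisModule W p)) 1 := fun v hv =>
      (BirchSwinnertonDyer.Theorems.StrictSelmerBridge.localization_primary_mem_unramifiedSubgroup_iff_mem_unramifiedKer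
        W p v c).mpr (hur v (fun h => hv (Set.mem_singleton_iff.mp h)))
    refine ⟨⟨fun v hvQ => ?_, fun w => ?_, fun v hvQ => hur' v (fun h => hvpQ (h ▸ hvQ))⟩, h0⟩
    · by_cases hvp : v = primePlace p
      · subst hvp
        exact BirchSwinnertonDyer.Theorems.KatoFiniteLevelCount.mem_selmerLocalKerPrimary_of_localization_eq_zero
          W p _ c h0
      · have h := hur' v hvp
        have h' : galoisCohomology.localization (primaryGaloisModule W p) (Sum.inr v) 1 c ∈
            unramifiedSubgroup (GaloisRep.restrictField (v.adicCompletion ℚ) (primaryGaloisModule W p)) 1 := h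
        rw [hgood v hvQ hvp] at h'
        exact BirchSwinnertonDyer.Theorems.KatoFiniteLevelCount.mem_selmerLocalKerPrimary_of_localization_eq_zero
          W p _ c ((AddSubgroup.mem_bot).mp h')
    · exact BirchSwinnertonDyer.Theorems.KatoFiniteLevelCount.mem_selmerLocalKerPrimary_infinitePlace_of_odd W p hodd w c
  · rintro ⟨⟨hoff, -, hQur⟩, h0⟩
    refine ⟨fun v hv => ?_, fun v hv => ?_⟩
    · rw [Set.mem_singleton_iff.mp hv]
      exact (BirchSwinnertonDyer.Theorems.StrictSelmerBridge.localization_primary_eq_zero_iff_mem_subgroupResKer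
        W p _ c).mp h0
    · have hvp : v ≠ primePlace p := fun h => hv (Set.mem_singleton_iff.mpr h)
      refine (BirchSwinnertonDyer.Theorems.StrictSelmerBridge.localization_primary_mem_unramifiedSubgroup_iff_mem_unramifiedKer
        W p v c).mp ?_
      by_cases hvQ : v ∈ Q
      · exact hQur v hvQ
      · rw [BirchSwinnertonDyer.Theorems.KatoFiniteLevelCount.localization_eq_zero_of_mem_selmerLocalKerPrimary W p hvp
          (hoff v hvQ)]
        exact zero_mem _

end Strict

/-! ## §2 The strict Selmer count on the rank-one rows -/

section Rows

open Summit.BirchSwinnertonDyer.Rank1Residual.Additive.GlobalKummer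
  Summit.BirchSwinnertonDyer.BirchSwinnertonDyer.Theorems.CongruentShaFreeCutKatoKummerLogTorsion

variable (W : WeierstrassCurve ℚ) [W.IsElliptic] [W.IsGloballyMinimal] (p : ℕ) [hp : Fact p.Prime]
  [ContinuousSMul ℤ_[p] (W.tateModule p)]

/-- **The lattice exponent is well defined**: if `H¹(ℤ[1/p], T_pW) = ℤ_p ∙ (p^a • x) = ℤ_p ∙ (p^b • x)` for the `T_p`-adic Kummer
class `x = κ_∞(P)` of a point `P` of infinite order, then `a = b` (no non-zero `c ∈ ℤ_p` kills `x`: `c • x = 0` would force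
`log_ω P = 0`, `HasLocPKummerLog.eq_zero_of_smul_eq_zero`, `padicLogLocal_map_ne_zero`). [cite: Kato2004Asterisque, §14.18 (p. 244)]
[cite: BlochKato1990, Ex. 3.11] -/
theorem eq_of_integralH1_eq_span_pow_smul {P : W.toAffine.Point} (hP : ¬ IsOfFinAddOrder P) {x : H1 (tateRep W p) ⊤}
    (hx : ∀ j : ℕ,
      (ofTopSubgroup (W.torsionGaloisModule ((p : ℤ) ^ j)).toTopRep 1).hom (reduceH1Pk W p j ⊤ x) =
        kummerMapTorsion W ((p : ℤ) ^ j) (zsmul_pow_surjective W p j) P)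
    {a b : ℕ} (ha : integralH1 (tateRep W p) p ⊤ = ℤ_[p] ∙ (p ^ a • x))
    (hb : integralH1 (tateRep W p) p ⊤ = ℤ_[p] ∙ (p ^ b • x)) : a = b := by
  have hp' : p.Prime := hp.out
  have hxlog := hasLocPKummerLog_of_forall_eq W p (zsmul_pow_surjective W p) hx
  have ht0 := LocPKummer.padicLogLocal_map_ne_zero W p hP
  have hne : ∀ c : ℤ_[p], c ≠ 0 → c • x ≠ 0 := fun c hc hcx =>
    ht0 (ContraCount.HasLocPKummerLog.eq_zero_of_smul_eq_zero W p hc hcx hxlog)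
  -- no unit congruence `1 = ν p^k` with `k ≥ 1`
  have hunit : ∀ (ν : ℤ_[p]) (k : ℕ), 0 < k → (1 : ℤ_[p]) - ν * (p : ℤ_[p]) ^ k ≠ 0 := by
    intro ν k hk h
    rw [sub_eq_zero] at h
    by_cases hν : ν = 0
    · rw [hν, zero_mul] at h; exact one_ne_zero h
    · have hv := PadicInt.valuation_p_pow_mul k ν hν
      rw [mul_comm, ← h, PadicInt.valuation_one] at hv
      omega
  -- `p^a • x ∈ ℤ_p ∙ (p^b • x)` and symmetrically
  have key : ∀ {a b : ℕ}, integralH1 (tateRep W p) p ⊤ = ℤ_[p] ∙ (p ^ a • x) →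
      integralH1 (tateRep W p) p ⊤ = ℤ_[p] ∙ (p ^ b • x) → ¬ a < b := by
    intro a b ha hb hlt
    have hmem : p ^ a • x ∈ ℤ_[p] ∙ (p ^ b • x) := by rw [← hb, ha]; exact Submodule.mem_span_singleton_self _
    obtain ⟨ν, hν⟩ := Submodule.mem_span_singleton.mp hmem
    obtain ⟨k, hk⟩ : ∃ k, b = a + k := ⟨b - a, by omega⟩
    have hk0 : 0 < k := by omega
    apply hne ((p : ℤ_[p]) ^ a * (1 - ν * (p : ℤ_[p]) ^ k))
      (mul_ne_zero (pow_ne_zero _ (by exact_mod_cast hp'.ne_zero)) (hunit ν k hk0))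
    rw [mul_sub, mul_one, sub_smul, ← mul_assoc, mul_comm ((p : ℤ_[p]) ^ a) ν, mul_assoc, ← pow_add, ← hk,
      mul_smul, ← Nat.cast_pow, ← Nat.cast_pow, Nat.cast_smul_eq_nsmul, Nat.cast_smul_eq_nsmul, hν, sub_self]
  rcases Nat.lt_trichotomy a b with h | h | h
  · exact absurd h (key ha hb)
  · exact h
  · exact absurd h (key hb ha)

omit [W.IsElliptic] [W.IsGloballyMinimal] [ContinuousSMul ℤ_[p] (W.tateModule p)] in
/-- `v_p (∏ f) = Σ v_p f` for non-zero factors. [folklore] -/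
private theorem padicValNat_finset_prod {ι : Type*} (s : Finset ι) (f : ι → ℕ)
    (hf : ∀ i ∈ s, f i ≠ 0) : padicValNat p (∏ i ∈ s, f i) = ∑ i ∈ s, padicValNat p (f i) := by
  induction s using Finset.cons_induction with
  | empty => simp
  | cons a s ha ih =>
    rw [Finset.prod_cons, Finset.sum_cons, padicValNat.mul (hf a (Finset.mem_cons_self a s)) (Finset.prod_ne_zero_iff.mpr
      fun i hi ↦ hf i (Finset.mem_cons_of_mem hi)), ih fun i hi ↦ hf i (Finset.mem_cons_of_mem hi)]

omit [W.IsGloballyMinimal] [ContinuousSMul ℤ_[p] (W.tateModule p)] in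
/-- **`Tam(W) = (∏_{ℓ ∈ Σ} c_ℓ) · c_p`** for a finite set `Σ` of places `≠ v_p` containing every bad `ℓ ≠ p` (`c_v = 1` at the good
places, `localTamagawaNumber_eq_one_of_hasGoodReductionAt_holds`; `c_{v_p}` read on `W ⊗ ℚ_p`, `localTamagawaNumber_padic_eq_holds`).
[cite: SilvermanAEC2009, Cor. VII.6.2 and VII.2 (remark after Prop. 2.1)] -/
theorem tamagawaProduct_eq_prod_mul_padic (Q : Finset (HeightOneSpectrum (𝓞 ℚ)))
    (hQp : ∀ v ∈ Q, ((Rat.HeightOneSpectrum.primesEquiv v : Nat.Primes) : ℕ) ≠ p)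
    (hQbad : ∀ v : HeightOneSpectrum (𝓞 ℚ), v ∈ W.badPlaces (𝓞 ℚ) →
      ((Rat.HeightOneSpectrum.primesEquiv v : Nat.Primes) : ℕ) ≠ p → v ∈ Q) :
    W.tamagawaProduct =
      (∏ v ∈ Q, (W.baseChange (v.adicCompletion ℚ)).localTamagawaNumber (v.adicCompletionIntegers ℚ)) *
        (W.baseChange ℚ_[p]).localTamagawaNumber ℤ_[p] := by
  have hvpQ : primePlace p ∉ Q := fun h => hQp _ h (coe_primesEquiv_primePlace p)
  have hsupp : (Function.mulSupport fun v : HeightOneSpectrum (𝓞 ℚ) =>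
      (W.baseChange (v.adicCompletion ℚ)).localTamagawaNumber (v.adicCompletionIntegers ℚ)) ⊆
        ↑(insert (primePlace p) Q) := by
    intro v hv
    rw [Function.mem_mulSupport] at hv
    rw [Finset.coe_insert, Set.mem_insert_iff, Finset.mem_coe]
    by_cases hvp : v = primePlace p
    · exact Or.inl hvp
    · right
      have hne : ((Rat.HeightOneSpectrum.primesEquiv v : Nat.Primes) : ℕ) ≠ p := by
        intro h
        apply hvp
        apply (Rat.HeightOneSpectrum.primesEquiv (R := 𝓞 ℚ)).injective
        rw [primesEquiv_primePlace]
        exact Subtype.ext h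
      refine hQbad v ((W.mem_badPlaces_iff v).mpr fun hgood => hv ?_) hne
      exact W.localTamagawaNumber_eq_one_of_hasGoodReductionAt_holds v hgood
  unfold WeierstrassCurve.tamagawaProduct
  rw [finprod_eq_prod_of_mulSupport_subset _ hsupp, Finset.prod_insert hvpQ, mul_comm,
    localTamagawaNumber_padic_eq_holds W (primePlace p) p (coe_primesEquiv_primePlace p)]

/-- **THE STRICT SELMER COUNT ON THE RANK-ONE ROWS.**  `W/ℚ` globally minimal, `p` odd, ADDITIVE reduction at `p` (`Addv W p`),
`rank_ℤ W(ℚ) = 1` generated by `P` modulo torsion, `Ш(W/ℚ)[p^∞]` finite, `p ∤ #W(ℚ)_tors`; `x = κ_∞(P) ∈ H¹(ℚ, T_pW)`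
(`ofTop(red_{p^k} x) = κ_{p^k}(P)`) with `H¹(ℤ[1/p], T_pW) = ℤ_p ∙ (p^a • x)`; `Σ` (`= Q`) a finite set of ADDITIVE places `≠ v_p`
containing every bad `ℓ ≠ p`.  THEN `Sel_str = katoStrictSelmer W p {v_p}` (unramified off `p`, locally trivial at `p`) is
FINITE and **`v_p #Sel_str + v_p #W(ℚ_p)[p^∞] + a = v_p #Ш[p^∞] + v_p Tam(W) + v(log_ω P)`** (§1; Part 31a §1 at `E = ℚ_{v_p}`
with `λ = p^{−e} log_ω` transported along `ℚ_{v_p} ≅ ℚ_p`, `ñ = v(log_ω P) − e`, `e = t − v_p c_p`, `p^t = #W(ℚ_p)[p^∞]`;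
Part 30 `[S_Σ : Sel_{p^∞}] · p^a = ∏_{ℓ∈Σ} p^{v_p c_ℓ}`; `Tam = (∏_{ℓ∈Σ} c_ℓ) · c_p`). [cite: Kato2004Asterisque, §14.1 (p. 235),
(14.9.3) (p. 240), Prop. 14.16 (p. 244)] [cite: GreenbergLNM1716, §2 (pp. 62–63)] [cite: KuriharaPollack2007, §1.5 (p. 361)] -/
theorem finite_katoStrictSelmer_and_padicValNat_card_eq (hodd : p ≠ 2) (hadd : Addv W p) (hrank : W.mordellWeilRank = 1)
    (hsha : Finite (AddCommGroup.primaryComponent W.sha p)) (htors : ¬ p ∣ W.torsionOrder) {P : W.toAffine.Point}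
    (hgen : ∀ R : W.toAffine.Point, ∃ n : ℤ, IsOfFinAddOrder (R - n • P)) {x : H1 (tateRep W p) ⊤}
    (hx : ∀ j : ℕ,
      (ofTopSubgroup (W.torsionGaloisModule ((p : ℤ) ^ j)).toTopRep 1).hom (reduceH1Pk W p j ⊤ x) =
        kummerMapTorsion W ((p : ℤ) ^ j) (zsmul_pow_surjective W p j) P)
    (Q : Finset (HeightOneSpectrum (𝓞 ℚ)))
    (hQp : ∀ v ∈ Q, ((Rat.HeightOneSpectrum.primesEquiv v : Nat.Primes) : ℕ) ≠ p)
    (hQadd : ∀ v ∈ Q, W.HasAdditiveReductionAt v)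
    (hQbad : ∀ v : HeightOneSpectrum (𝓞 ℚ), v ∈ W.badPlaces (𝓞 ℚ) →
      ((Rat.HeightOneSpectrum.primesEquiv v : Nat.Primes) : ℕ) ≠ p → v ∈ Q)
    {a : ℕ} (ha : integralH1 (tateRep W p) p ⊤ = ℤ_[p] ∙ (p ^ a • x)) :
    Finite (katoStrictSelmer W p {primePlace p}) ∧
      (padicValNat p (Nat.card (katoStrictSelmer W p {primePlace p})) : ℤ) +
          padicValNat p (Nat.card (AddCommGroup.primaryComponent
            (W.baseChange ((primePlace p).adicCompletion ℚ)).toAffine.Point p)) + a =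
        padicValNat p (Nat.card (AddCommGroup.primaryComponent W.sha p)) + padicValNat p W.tamagawaProduct +
          (padicLogLocal W p (Affine.Point.map (W' := W.toAffine) (S := ℚ) (Algebra.ofId ℚ ℚ_[p]) P)).valuation := by
  have hp' : p.Prime := hp.out
  haveI := hsha
  have hP : ¬ IsOfFinAddOrder P := ContraCount.not_isOfFinAddOrder_of_generates hrank hgen
  have hvpQ : primePlace p ∉ Q := fun h => hQp _ h (coe_primesEquiv_primePlace p)
  -- the auxiliary set `T = Σ ∪ {v_p}` of Part 30
  have hTp : ∀ v : HeightOneSpectrum (𝓞 ℚ), ((p : ℕ) : 𝓞 ℚ) ∈ v.asIdeal → v ∈ insert (primePlace p) Q := fun v hv =>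
    Finset.mem_insert.mpr (Or.inl (BirchSwinnertonDyer.Theorems.KatoFiniteLevelCount.eq_primePlace_of_natCast_mem p hv))
  have hTbad : ∀ v : HeightOneSpectrum (𝓞 ℚ), ¬ W.HasGoodReductionAt v → v ∈ insert (primePlace p) Q := by
    intro v hv
    rw [Finset.mem_insert]
    by_cases hvp : v = primePlace p
    · exact Or.inl hvp
    · right
      refine hQbad v ((W.mem_badPlaces_iff v).mpr hv) fun h => hvp ?_
      apply (Rat.HeightOneSpectrum.primesEquiv (R := 𝓞 ℚ)).injective
      rw [primesEquiv_primePlace]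
      exact Subtype.ext h
  -- (R1-d), Part 30
  obtain ⟨a₀, hA₀, S, hS, hle, hne, hprod, -⟩ :=
    KummerUnramified.exists_relIndex_selmerGroup_eq_pow_and_mul_eq W p hodd hrank hsha htors hgen hx Q
      (insert (primePlace p) Q) (Finset.subset_insert _ _) hQp hQadd hQbad hTp hTbad
  obtain rfl : a = a₀ := eq_of_integralH1_eq_span_pow_smul W p hP hx ha hA₀
  -- the local field `ℚ_{v_p}` (written out: a `set` abbreviation for the TYPE makes `isDefEq` expensive) and `ℚ_p`
  let ι : ℚ_[p] →ₐ[ℚ] (primePlace p).adicCompletion ℚ := padicToAdic p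
  let ε : ((primePlace p).adicCompletion ℚ) →ₐ[ℚ] ℚ_[p] :=
    ((Padic.adicCompletionEquiv (R := 𝓞 ℚ) ⟨p, hp'⟩).symm.toAlgEquiv : ((primePlace p).adicCompletion ℚ) ≃ₐ[ℚ] ℚ_[p]).toAlgHom
  have hει : ∀ y, ε (ι y) = y := fun y => (Padic.adicCompletionEquiv (R := 𝓞 ℚ) ⟨p, hp'⟩).symm_apply_apply y
  have hιε : ∀ z, ι (ε z) = z := fun z => (Padic.adicCompletionEquiv (R := 𝓞 ℚ) ⟨p, hp'⟩).apply_symm_apply z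
  let mε : (W.baseChange ((primePlace p).adicCompletion ℚ)).toAffine.Point →+ (W.baseChange ℚ_[p]).toAffine.Point :=
    Affine.Point.map (W' := W.toAffine) (S := ℚ) ε
  let mι : (W.baseChange ℚ_[p]).toAffine.Point →+ (W.baseChange ((primePlace p).adicCompletion ℚ)).toAffine.Point :=
    Affine.Point.map (W' := W.toAffine) (S := ℚ) ι
  have hmει : ∀ X, mε (mι X) = X := fun X => by
    change Affine.Point.map (W' := W.toAffine) (S := ℚ) ε (Affine.Point.map (W' := W.toAffine) (S := ℚ) ι X) = X
    rw [Affine.Point.map_map]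
    exact point_map_eq_self_of_forall_apply_eq W (ε.comp ι) hει X
  have hmιε : ∀ X, mι (mε X) = X := fun X => by
    change Affine.Point.map (W' := W.toAffine) (S := ℚ) ι (Affine.Point.map (W' := W.toAffine) (S := ℚ) ε X) = X
    rw [Affine.Point.map_map]
    exact point_map_eq_self_of_forall_apply_eq W (ι.comp ε) hιε X
  have hmε_inj : Function.Injective mε := Affine.Point.map_injective (W' := W.toAffine) ε
  -- `λ = p^{-e} log_ω` on `E(ℚ_p)` and its transport `λ_v` to `E(ℚ_{v_p})`
  obtain ⟨lam, hlam0, hsurj, hlamlog⟩ :=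
    exists_hom_padicInt_of_range_padicLog (W.baseChange ℚ_[p]) (LocalLog.range_padicLog_baseChange_of_addv W p hadd)
  let lamv : (W.baseChange ((primePlace p).adicCompletion ℚ)).toAffine.Point →+ ℤ_[p] := lam.comp mε
  have hlamv0 : ∀ X, lamv X = 0 ↔ IsOfFinAddOrder X := fun X =>
    (hlam0 (mε X)).trans (hmε_inj.isOfFinAddOrder_iff (f := mε))
  have hsurjv : Function.Surjective lamv := fun z => by
    obtain ⟨Y, hY⟩ := hsurj z
    exact ⟨mι Y, by change lam (mε (mι Y)) = z; rw [hmει]; exact hY⟩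
  have hlambv : ∀ z : ℤ_[p], ∃ Y, lamv Y = (p : ℤ_[p]) ^ 0 * z := fun z => by
    obtain ⟨Y, hY⟩ := hsurjv z
    exact ⟨Y, by rw [pow_zero, one_mul]; exact hY⟩
  -- the point `P` over `ℚ_{v_p}` and over `ℚ_p`
  set X₀ : (W.baseChange ((primePlace p).adicCompletion ℚ)).toAffine.Point := Affine.Point.baseChange (W' := W) ℚ ((primePlace p).adicCompletion ℚ) P with hX₀
  have hX₀ε : mε X₀ = Affine.Point.map (W' := W.toAffine) (S := ℚ) (Algebra.ofId ℚ ℚ_[p]) P :=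
    Affine.Point.map_baseChange (W' := W.toAffine) ε P
  have hX₀fin : ¬ IsOfFinAddOrder X₀ := fun h =>
    hP ((Affine.Point.map_injective (W' := W.toAffine) (Algebra.ofId ℚ ((primePlace p).adicCompletion ℚ))).isOfFinAddOrder_iff
      (f := Affine.Point.baseChange (W' := W) ℚ ((primePlace p).adicCompletion ℚ)) |>.mp h)
  have hX₀0 : lamv X₀ ≠ 0 := fun h => hX₀fin ((hlamv0 X₀).mp h)
  obtain ⟨hdivP, hndiv⟩ := modTorsion_level_of_surjective p lamv hlamv0 hsurjv hX₀0
  -- `ñ = v(log_ω P) − e`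
  have hñ : ((lamv X₀).valuation : ℤ) =
      (padicLogLocal W p (Affine.Point.map (W' := W.toAffine) (S := ℚ) (Algebra.ofId ℚ ℚ_[p]) P)).valuation -
        ((padicValNat p (Nat.card (AddCommGroup.torsion (W.baseChange ℚ_[p]).toAffine.Point)) : ℤ) -
          padicValNat p ((W.baseChange ℚ_[p]).localTamagawaNumber ℤ_[p])) := by
    have h := valuation_eq_valuation_padicLog_sub (W.baseChange ℚ_[p]) lam hlamlog (Q := mε X₀) hX₀0
    change ((lam (mε X₀)).valuation : ℤ) = _
    rw [hX₀ε] at h ⊢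
    rw [← padicLogLocal_eq_padicLog] at h
    exact h
  -- `#W(ℚ_{v_p})[p^∞] = p^t`
  have ht : Nat.card (AddCommGroup.primaryComponent (W.baseChange ((primePlace p).adicCompletion ℚ)).toAffine.Point p) =
      p ^ padicValNat p (Nat.card (AddCommGroup.torsion (W.baseChange ℚ_[p]).toAffine.Point)) := by
    rw [natCard_primaryComponent_eq_of_inverse mε mι hmιε hmει p]
    exact LocalLog.natCard_primaryComponent_point_eq_pow (W.baseChange ℚ_[p])
  -- §1 at `E = ℚ_{v_p}`, `S = S_Σ`
  have hSloc : S ≤ selmerLocalKerPrimary W ((primePlace p).adicCompletion ℚ) p := fun y hy => ((hS y).mp hy).1 (primePlace p) hvpQ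
  have hgen' : ∀ R : W.toAffine.Point, ∃ (k : ℤ) (T : W.toAffine.Point), IsOfFinAddOrder T ∧ R = k • P + T := by
    intro R
    obtain ⟨n, hn⟩ := hgen R
    exact ⟨n, R - n • P, hn, by abel⟩
  haveI : PerfectField ((primePlace p).adicCompletion ℚ) :=
    @PerfectField.ofCharZero _ _
      (charZero_of_injective_ringHom (algebraMap ℚ ((primePlace p).adicCompletion ℚ)).injective)
  -- (§1 is elaborated with the classical `DecidableEq` on `W(ℚ)`; `convert` bridges the subsingleton instance gap)
  have hcount : Nat.card ↥(S ⊓ selmerLocalKerPrimaryTorsion W ((primePlace p).adicCompletion ℚ) p) =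
      p ^ (lamv X₀).valuation *
        ((W.selmerGroupPInfty p).relIndex S * Nat.card (AddCommGroup.primaryComponent W.sha p)) := by
    refine card_inf_strict_eq_pow_mul_relIndex_mul_card_sha_modTorsion W p ((primePlace p).adicCompletion ℚ) lamv hlamv0 hlambv S hSloc hle
      (P := P) ?_ ?_ ?_ ?_
    · convert hP
    · intro R
      obtain ⟨k, T, hT, hR⟩ := hgen' R
      exact ⟨k, T, by convert hT, by convert hR⟩
    · obtain ⟨Q₁, T₁, hT₁, hQ₁⟩ := hdivP
      exact ⟨Q₁, T₁, hT₁, by convert hQ₁ using 2; exact hX₀.symm⟩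
    · intro Q₁ T₁ hT₁ h
      exact hndiv Q₁ T₁ hT₁ (by convert h using 2; exact hX₀)
  replace hcount : Nat.card (katoStrictSelmer W p {primePlace p}) =
      p ^ (lamv X₀).valuation *
        ((W.selmerGroupPInfty p).relIndex S * Nat.card (AddCommGroup.primaryComponent W.sha p)) := by
    rw [katoStrictSelmer_eq_inf_strict W p hodd Q hQp hQbad S hS]
    exact hcount
  -- finiteness
  have hcard0 : Nat.card (katoStrictSelmer W p {primePlace p}) ≠ 0 := by
    rw [hcount]
    exact mul_ne_zero (pow_ne_zero _ hp'.ne_zero) (mul_ne_zero hne (Nat.card_pos (α := _)).ne')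
  have hfin : Finite (katoStrictSelmer W p {primePlace p}) := Nat.finite_of_card_ne_zero hcard0
  refine ⟨hfin, ?_⟩
  -- valuations
  have hrel0 : (W.selmerGroupPInfty p).relIndex S ≠ 0 := hne
  have hsha0 : Nat.card (AddCommGroup.primaryComponent W.sha p) ≠ 0 := (Nat.card_pos (α := _)).ne'
  have hv1 : padicValNat p (Nat.card (katoStrictSelmer W p {primePlace p})) =
      (lamv X₀).valuation + (padicValNat p ((W.selmerGroupPInfty p).relIndex S) +
        padicValNat p (Nat.card (AddCommGroup.primaryComponent W.sha p))) := by
    rw [hcount, padicValNat.mul (pow_ne_zero _ hp'.ne_zero) (mul_ne_zero hrel0 hsha0), padicValNat.prime_pow,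
      padicValNat.mul hrel0 hsha0]
  -- Part 30's product, in valuations
  have hv2 : padicValNat p ((W.selmerGroupPInfty p).relIndex S) + a =
      ∑ v ∈ Q, padicValNat p ((W.baseChange (v.adicCompletion ℚ)).localTamagawaNumber (v.adicCompletionIntegers ℚ)) := by
    have h := congrArg (padicValNat p) hprod
    rw [padicValNat.mul hrel0 (pow_ne_zero _ hp'.ne_zero), padicValNat.prime_pow,
      Finset.prod_pow_eq_pow_sum, padicValNat.prime_pow] at h
    exact h
  -- Tamagawa
  have hc0 : ∀ v ∈ Q, (W.baseChange (v.adicCompletion ℚ)).localTamagawaNumber (v.adicCompletionIntegers ℚ) ≠ 0 :=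
    fun v _ => W.localTamagawaNumber_baseChange_ne_zero v
  have hcp0 : (W.baseChange ℚ_[p]).localTamagawaNumber ℤ_[p] ≠ 0 :=
    localTamagawaNumber_padic_ne_zero_holds p (W.baseChange ℚ_[p])
  have hv3 : padicValNat p W.tamagawaProduct =
      (∑ v ∈ Q, padicValNat p ((W.baseChange (v.adicCompletion ℚ)).localTamagawaNumber (v.adicCompletionIntegers ℚ))) +
        padicValNat p ((W.baseChange ℚ_[p]).localTamagawaNumber ℤ_[p]) := by
    rw [tamagawaProduct_eq_prod_mul_padic W p Q hQp hQbad, padicValNat.mul (Finset.prod_ne_zero_iff.mpr hc0) hcp0,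
      padicValNat_finset_prod p Q _ hc0]
  rw [ht, padicValNat.prime_pow, hv1, hv3]
  have hv2' := congrArg (Nat.cast : ℕ → ℤ) hv2
  simp only [Nat.cast_add] at hv2' ⊢
  linarith [hñ, hv2']

end Rows

end Summit.BirchSwinnertonDyer.Rank1Residual.Additive.StrictCount

end
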